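import Mathlib
import HarnessLib
import Literature.Analysis.FluidPDE.TypeIAncientMild
import Literature.Analysis.FluidPDE.TypeIAncientMildRescale
import Literature.Analysis.FluidPDE.LerayHopfNSRescale
import Summits.NavierStokesRegularity.NavierStokesRegularity.Theorems.QuarterLogPincerQuietCollarDefs
import Summits.NavierStokesRegularity.NavierStokesRegularity.Theorems.PoloidalWindowDoorPoloidalWindowRigidityClassSpaceTimeRates

/-!
# Line `quiet_core` — auxiliary workfile `Lines/quiet_core_concentration.lean` (v1.8; ns-idea-7 g10, lens «nearmiss»)

Crux `QuarterLogPincer.TypeIQuantSubcubicExp` (stmt-NavierStokesRegularity-24077).  **No summit is proved by this file**;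
it has NO stub and NO `sorry` (the line's skeleton is `Lines/quiet_core.lean`, at the 200 kB workfile cap — hence a
separate module; crux workfiles are not importable, so the two floor theorems of the main file enter BY STATEMENT:
`EnergyClassFloorTheorem` = §6 `localRateFloor_of_singularAt_L2`, `LocalRateFloorLogCube'` = §5 `localRateFloorLogCube`,
both PROVED there with std axioms; everything below is unconditional in them).

CONTENT.
* §A  RATE FLOOR ⇒ PARABOLIC PLATEAU ⇒ CRITICAL CONCENTRATION (class-generic, elementary): the class's uniform spatial
  Lipschitz rate `‖∇v(s)‖ ≤ K(M)/(−s)` (`exists_spaceTime_rate_of_class`, KNSS local smoothing — landed) turns a floor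
  point `‖v(s,x₀)‖ ≥ c/√(−s)` into the plateau `‖v(s)‖ ≥ c/(2√(−s))` on `B(x₀, ρ√(−s))`, `ρ = min 1 (c/2K)`, hence
  `∫_{B(x₀,ρ√(−s))} ‖v(s)‖³ ≥ γ = |B₁|(ρc/2)³` at every late time (`parabolicPlateau_of_floor`,
  `lThreeConcentration_of_floorIn`, `lThreeConcentration_of_localRateFloor`).
* §B  THE FLOOR IS CARRIED INTO THE APEX, energy class: the class `(M, E)` is scale-STABLE (`localEnergyBound_nsRescale`:
  the zoom `v_λ = λv(λ²·, λ·)`, `0 < λ ≤ 1`, has unit-scale energy `≤ E/λ`; `IsTypeIAncientMild.nsRescale` landed;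
  `singularAt_zero_nsRescale`), so the §6 floor theorem applied to `v_λ` and unscaled gives a floor in EVERY ball
  `B(0,λ)`: `multiscaleFloor_of_energyClassFloorTheorem : … → ∀ λ ∈ (0,1], FloorIn λ v`.
* §C  the same for the log-cube class, whose budget constant is scale-stable with a log loss `B ↦ B(1 + 2log(1/λ))`
  (`eLpNorm_indicator_ball_nsRescale`: the localised critical norm is scale-invariant; `envelopeCubeBudget_nsRescale`;
  `multiscaleFloor_of_localRateFloorLogCube`).
* §D  APEX CONCENTRATION (both classes): for every `λ ∈ (0,1]`, at all late times a parabolic ball `B(x₀, ρ_λ√(−s))` with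
  `‖x₀‖ < λ` carries the plateau `a_λ/√(−s)` and critical mass `γ_λ` (`apexConcentration_energyClass`,
  `apexConcentration_logCube`).
* §E  UNIFORM CONSTANTS (granted main file §7 `uniformFloor_L2` / `uniformFloor_logCube`, v1.8: the level `c₀(M)` of S3♭ is
  budget-free): `uniformApexFloor_*` (`∃ c(M) > 0, ∀ λ ∈ (0,1], ∃ s_λ, ∀ s ∈ [s_λ,0), ∃ x ∈ B(0,λ), ‖v(s,x)‖ ≥ c/√(−s)`) and
  `uniformApexConcentration_*` (`γ, ρ, a` depend on `M` ONLY; only the onset time depends on `λ`): critical mass `γ(M)`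
  on parabolic balls whose centres tend to the apex.

READING.  This is the BP2020-Thm-2-type conclusion — critical-norm concentration on parabolic balls near the singularity
at ALL late times — for the two ANCIENT classes of crux 24077 (log-cube objects; THIN objects of the left edge), which the
near-miss census recorded as missing (BP2020 Thm 2 / BP2021 live in global Leray–Hopf classes).  Honest residue: the
centre is pinned within any FIXED `λ` of the apex from a `λ`-dependent onset time `s_λ` on (level and mass are uniform, §E),
not at the parabolic distance `R√(−s)` of BP2020; the RATE `λ(s)` would need the onset time `s₂(M, E)` of the energy /
budget pass explicitly (it is polynomial in `E`, resp. `B`, on paper; hidden existentially in `EnergyPass` / `BudgetPass`).  For the 24077 left-edge leads: the deciding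
Liouville statement may assume its thin singular object NON-FLICKERING AT EVERY SCALE around the apex.
bears_on: LADDER-NS W7.  No Liouville theorem is proved; 24077, Q2♭, QP2 and NS regularity are OPEN.
-/

set_option linter.dupNamespace false

namespace Summit.NavierStokesRegularity.NavierStokesRegularity.Cruxes.TypeIQuantSubcubicExp.QuietCore

open MeasureTheory Set Function Metric Filter Topology
open scoped ENNReal NNReal
open Literature.Analysis Literature.Analysis.FluidPDE
open Summit.NavierStokesRegularity.NavierStokesRegularity.Cruxes.TypeIQuantSubcubicExp.QuietCollar (LocalRateFloor)
open Summit.NavierStokesRegularity.NavierStokesRegularity.Cruxes.TypeIQuantSubcubicExp.ThinCascade (SingularAt)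
open Summit.NavierStokesRegularity.NavierStokesRegularity.Cruxes.TypeIQuantSubcubicExp.TruncationEdge (EnvelopeCubeBudget)
open Summit.NavierStokesRegularity.NavierStokesRegularity.Theorems.PoloidalWindowDoorPoloidalWindowRigidityClassSpaceTimeRates
  (exists_spaceTime_rate_of_class)

/-- **Uniform spatial Lipschitz rate of the class** (scaling-sharp form of KNSS local smoothing): for every `M` there is
`K > 0` with `‖v(s,x) − v(s,y)‖ ≤ K/(−s)·‖x − y‖` for every Type-I ancient mild field with constant `M`, every `s < 0`. -/
theorem uniform_spatial_lipschitz (M : ℝ) :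
    ∃ K : ℝ, 0 < K ∧ ∀ v : ℝ → EuclideanSpace ℝ (Fin 3) → EuclideanSpace ℝ (Fin 3),
      IsTypeIAncientMild M v → ∀ s < (0 : ℝ), ∀ x y : EuclideanSpace ℝ (Fin 3),
        ‖v s x - v s y‖ ≤ K / (-s) * ‖x - y‖ := by
  obtain ⟨Kx, hKx0, hKx'⟩ := exists_spaceTime_rate_of_class M 1 0
  refine ⟨Kx + 1, by linarith, fun v hv s hs x y => ?_⟩
  have hcont : ContinuousOn (uncurry v) (Iio (0 : ℝ) ×ˢ univ) := hv.1.continuousOn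
  have hmild : ∀ s t : ℝ, s < t → t < 0 → ∀ y,
      v t y = UnboundedOperators.heatExtension (v s) (t - s) y - oseenDuhamel 1 s v v t y :=
    fun s t hst ht y => hv.mild_eq_heatExtension hst ht y
  have hKx : ∀ y, ‖fderiv ℝ (v s) y‖ ≤ Kx / (-s) := by
    intro y
    have h := hKx' v hv.2.2.2 hcont hmild s hs y
    have hid : (fun y' => iteratedDeriv 0 (fun τ => v τ y') s) = v s := by
      funext y'; rw [iteratedDeriv_zero]
    rw [hid, norm_iteratedFDeriv_one] at h
    have h2 : Real.sqrt (-s) ^ (1 + 2 * 0 + 1) = -s := by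
      rw [show 1 + 2 * 0 + 1 = 2 by norm_num, Real.sq_sqrt (neg_pos.2 hs).le]
    rwa [h2] at h
  have hslice : ∀ z : EuclideanSpace ℝ (Fin 3), DifferentiableAt ℝ (v s) z :=
    fun z => ((hv.contDiff_slice hs).differentiable (by simp)).differentiableAt
  have hbound : ∀ z ∈ (univ : Set (EuclideanSpace ℝ (Fin 3))), ‖fderiv ℝ (v s) z‖ ≤ (Kx + 1) / (-s) := by
    intro z _
    refine (hKx z).trans ?_
    exact div_le_div_of_nonneg_right (by linarith) (neg_pos.2 hs).le
  have := Convex.norm_image_sub_le_of_norm_fderiv_le (fun z _ => hslice z) hbound convex_univ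
    (mem_univ y) (mem_univ x)
  simpa using this

/-- **PARABOLIC PLATEAU from a floor point.**  If `‖v(s,x₀)‖ ≥ c/√(−s)` at some `s < 0` (`c > 0`) for a Type-I ancient
mild field of the class, then `‖v(s,y)‖ ≥ c/(2√(−s))` on the parabolic ball `B(x₀, ρ√(−s))`, `ρ = min 1 (c/(2K))`,
`K = K(M)` the class Lipschitz constant. -/
theorem parabolicPlateau_of_floor (M : ℝ) :
    ∃ K : ℝ, 0 < K ∧ ∀ v : ℝ → EuclideanSpace ℝ (Fin 3) → EuclideanSpace ℝ (Fin 3),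
      IsTypeIAncientMild M v → ∀ c : ℝ, 0 < c → ∀ s < (0 : ℝ), ∀ x₀ : EuclideanSpace ℝ (Fin 3),
        c / Real.sqrt (-s) ≤ ‖v s x₀‖ →
        ∀ y ∈ Metric.ball x₀ (min 1 (c / (2 * K)) * Real.sqrt (-s)), c / (2 * Real.sqrt (-s)) ≤ ‖v s y‖ := by
  obtain ⟨K, hK, hLip⟩ := uniform_spatial_lipschitz M
  refine ⟨K, hK, fun v hv c hc s hs x₀ hfloor y hy => ?_⟩
  have hσ : 0 < -s := neg_pos.2 hs
  set q : ℝ := Real.sqrt (-s) with hq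
  have hq0 : 0 < q := Real.sqrt_pos.2 hσ
  have hq2 : q * q = -s := Real.mul_self_sqrt hσ.le
  have hdist : ‖y - x₀‖ < min 1 (c / (2 * K)) * q := by rwa [mem_ball, dist_eq_norm] at hy
  have hρ : min 1 (c / (2 * K)) * q ≤ c / (2 * K) * q :=
    mul_le_mul_of_nonneg_right (min_le_right _ _) hq0.le
  -- the Lipschitz loss on the parabolic ball is at most half the floor
  have hloss : ‖v s y - v s x₀‖ ≤ c / (2 * q) := by
    have h1 := hLip v hv s hs y x₀
    have h2 : K / (-s) * ‖y - x₀‖ ≤ K / (-s) * (c / (2 * K) * q) :=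
      mul_le_mul_of_nonneg_left (hdist.le.trans hρ) (div_nonneg hK.le hσ.le)
    have h3 : K / (-s) * (c / (2 * K) * q) = c / (2 * q) := by
      rw [← hq2]; field_simp
    linarith
  have h4 := norm_sub_norm_le (v s x₀) (v s y)
  rw [norm_sub_rev] at h4
  have h5 : c / q - c / (2 * q) = c / (2 * q) := by field_simp; ring
  -- `‖v s y‖ ≥ ‖v s x₀‖ − ‖v s y − v s x₀‖ ≥ c/q − c/(2q)`
  have : c / q - c / (2 * q) ≤ ‖v s y‖ := by linarith
  linarith

/-- **FLOOR POINT ⇒ PLATEAU + CRITICAL MASS on the parabolic ball** (per slice, constants from `M` and the level `c`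
only): with `K = K(M)` of `parabolicPlateau_of_floor` and `ρ = min 1 (c/2K)`, a floor point `‖v(s,x₀)‖ ≥ c/√(−s)` gives
`‖v(s)‖ ≥ c/(2√(−s))` on `B(x₀, ρ√(−s))` and `∫_{B(x₀,ρ√(−s))} ‖v(s)‖³ ≥ |B₁|(ρc/2)³`. -/
theorem concentration_of_floorPoint (M : ℝ) :
    ∃ K : ℝ, 0 < K ∧ ∀ v : ℝ → EuclideanSpace ℝ (Fin 3) → EuclideanSpace ℝ (Fin 3),
      IsTypeIAncientMild M v → ∀ c : ℝ, 0 < c → ∀ s < (0 : ℝ), ∀ x₀ : EuclideanSpace ℝ (Fin 3),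
        c / Real.sqrt (-s) ≤ ‖v s x₀‖ →
        (∀ y ∈ Metric.ball x₀ (min 1 (c / (2 * K)) * Real.sqrt (-s)), c / (2 * Real.sqrt (-s)) ≤ ‖v s y‖) ∧
        (volume (Metric.ball (0 : EuclideanSpace ℝ (Fin 3)) 1)).toReal * (min 1 (c / (2 * K)) * c / 2) ^ 3 ≤
          ∫ y in Metric.ball x₀ (min 1 (c / (2 * K)) * Real.sqrt (-s)), ‖v s y‖ ^ 3 := by
  obtain ⟨K, hK, hplat⟩ := parabolicPlateau_of_floor M
  refine ⟨K, hK, fun v hv c hc s hs0 x₀ hfx => ?_⟩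
  have hρ0 : 0 < min 1 (c / (2 * K)) := lt_min one_pos (by positivity)
  have hσ : 0 < -s := neg_pos.2 hs0
  set q : ℝ := Real.sqrt (-s) with hq
  have hq0 : 0 < q := Real.sqrt_pos.2 hσ
  have hP : ∀ y ∈ Metric.ball x₀ (min 1 (c / (2 * K)) * q), c / (2 * q) ≤ ‖v s y‖ :=
    hplat v hv c hc s hs0 x₀ hfx
  refine ⟨hP, ?_⟩
  set r : ℝ := min 1 (c / (2 * K)) * q with hr
  have hr0 : 0 < r := mul_pos hρ0 hq0
  have hI : IntegrableOn (fun y => ‖v s y‖ ^ 3) (Metric.ball x₀ r) volume :=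
    ((((hv.continuous_slice hs0).norm.pow 3).continuousOn.integrableOn_compact
      (isCompact_closedBall x₀ r)).mono_set Metric.ball_subset_closedBall)
  have hC : IntegrableOn (fun _ : EuclideanSpace ℝ (Fin 3) => (c / (2 * q)) ^ 3) (Metric.ball x₀ r) volume :=
    (((continuous_const : Continuous fun _ : EuclideanSpace ℝ (Fin 3) => (c / (2 * q)) ^ 3)
      |>.continuousOn.integrableOn_compact (isCompact_closedBall x₀ r)).mono_set Metric.ball_subset_closedBall)
  have hmono : ∫ y in Metric.ball x₀ r, (c / (2 * q)) ^ 3 ≤ ∫ y in Metric.ball x₀ r, ‖v s y‖ ^ 3 :=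
    setIntegral_mono_on hC hI measurableSet_ball fun y hy =>
      pow_le_pow_left₀ (by positivity) (hP y hy) 3
  have hconst : ∫ y in Metric.ball x₀ r, (c / (2 * q)) ^ 3 =
      (volume (Metric.ball x₀ r)).toReal * (c / (2 * q)) ^ 3 := by
    rw [setIntegral_const, smul_eq_mul, Measure.real]
  have hvol : (volume (Metric.ball x₀ r)).toReal =
      r ^ 3 * (volume (Metric.ball (0 : EuclideanSpace ℝ (Fin 3)) 1)).toReal := by
    rw [Measure.addHaar_ball_of_pos volume x₀ hr0, ENNReal.toReal_mul, finrank_euclideanSpace_fin,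
      ENNReal.toReal_ofReal (by positivity)]
  have hval : r ^ 3 * (c / (2 * q)) ^ 3 = (min 1 (c / (2 * K)) * c / 2) ^ 3 := by
    rw [← mul_pow]; congr 1; rw [hr]; field_simp
  calc (volume (Metric.ball (0 : EuclideanSpace ℝ (Fin 3)) 1)).toReal * (min 1 (c / (2 * K)) * c / 2) ^ 3
      = (volume (Metric.ball x₀ r)).toReal * (c / (2 * q)) ^ 3 := by
        rw [hvol, ← hval]; ring
    _ = ∫ y in Metric.ball x₀ r, (c / (2 * q)) ^ 3 := hconst.symm
    _ ≤ ∫ y in Metric.ball x₀ r, ‖v s y‖ ^ 3 := hmono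

/-- A rate floor carried by the ball `B(0,λ)`: `LocalRateFloor = FloorIn 1`. -/
def FloorIn (lam : ℝ) (v : ℝ → EuclideanSpace ℝ (Fin 3) → EuclideanSpace ℝ (Fin 3)) : Prop :=
  ∃ c s₀ : ℝ, 0 < c ∧ s₀ < 0 ∧ ∀ s ∈ Set.Ico s₀ 0,
    ∃ x ∈ Metric.ball (0 : EuclideanSpace ℝ (Fin 3)) lam, c / Real.sqrt (-s) ≤ ‖v s x‖

theorem floorIn_one_iff (v : ℝ → EuclideanSpace ℝ (Fin 3) → EuclideanSpace ℝ (Fin 3)) :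
    FloorIn 1 v ↔ LocalRateFloor v := Iff.rfl

theorem FloorIn.mono {lam lam' : ℝ} {v : ℝ → EuclideanSpace ℝ (Fin 3) → EuclideanSpace ℝ (Fin 3)}
    (h : FloorIn lam v) (hl : lam ≤ lam') : FloorIn lam' v := by
  obtain ⟨c, s₀, hc, hs₀, hf⟩ := h
  refine ⟨c, s₀, hc, hs₀, fun s hs => ?_⟩
  obtain ⟨x, hx, hcx⟩ := hf s hs
  exact ⟨x, Metric.ball_subset_ball hl hx, hcx⟩

/-- **RATE FLOOR ⇒ CRITICAL (L³) CONCENTRATION at the parabolic scale, uniformly in the late time** (floor carried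
by `B(0,λ)` ⇒ centre `x₀ ∈ B(0,λ)`; `γ, ρ, a` depend only on `M` and the floor constant). -/
theorem lThreeConcentration_of_floorIn {M lam : ℝ}
    {v : ℝ → EuclideanSpace ℝ (Fin 3) → EuclideanSpace ℝ (Fin 3)}
    (hv : IsTypeIAncientMild M v) (hfl : FloorIn lam v) :
    ∃ γ ρ a s₀ : ℝ, 0 < γ ∧ 0 < ρ ∧ ρ ≤ 1 ∧ 0 < a ∧ s₀ < 0 ∧ ∀ s ∈ Set.Ico s₀ 0,
      ∃ x₀ ∈ Metric.ball (0 : EuclideanSpace ℝ (Fin 3)) lam,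
        (∀ y ∈ Metric.ball x₀ (ρ * Real.sqrt (-s)), a / Real.sqrt (-s) ≤ ‖v s y‖) ∧
        γ ≤ ∫ y in Metric.ball x₀ (ρ * Real.sqrt (-s)), ‖v s y‖ ^ 3 := by
  obtain ⟨K, hK, hconc⟩ := concentration_of_floorPoint M
  obtain ⟨c, s₀, hc, hs₀, hfloor⟩ := hfl
  have hρ0 : 0 < min 1 (c / (2 * K)) := lt_min one_pos (by positivity)
  have hB : 0 < (volume (Metric.ball (0 : EuclideanSpace ℝ (Fin 3)) 1)).toReal :=
    ENNReal.toReal_pos (measure_ball_pos volume _ one_pos).ne' measure_ball_lt_top.ne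
  refine ⟨(volume (Metric.ball (0 : EuclideanSpace ℝ (Fin 3)) 1)).toReal * (min 1 (c / (2 * K)) * c / 2) ^ 3,
    min 1 (c / (2 * K)), c / 2, s₀, by positivity, hρ0, min_le_left _ _, by positivity, hs₀, fun s hs => ?_⟩
  obtain ⟨x₀, hx₀, hfx⟩ := hfloor s hs
  obtain ⟨hP, hI⟩ := hconc v hv c hc s hs.2 x₀ hfx
  refine ⟨x₀, hx₀, fun y hy => ?_, hI⟩
  rw [div_div]; exact hP y hy

/-- **RATE FLOOR ⇒ CRITICAL CONCENTRATION** (`LocalRateFloor = FloorIn 1`): with `Lines/quiet_core.lean` §5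
`localRateFloorLogCube` / §6 `localRateFloor_of_thinObject`, every log-cube and every thin SINGULAR object concentrates
critical mass `γ(M, c)` on a parabolic ball inside `B(0,2)` at all late times. -/
theorem lThreeConcentration_of_localRateFloor {M : ℝ}
    {v : ℝ → EuclideanSpace ℝ (Fin 3) → EuclideanSpace ℝ (Fin 3)}
    (hv : IsTypeIAncientMild M v) (hfl : LocalRateFloor v) :
    ∃ γ ρ a s₀ : ℝ, 0 < γ ∧ 0 < ρ ∧ ρ ≤ 1 ∧ 0 < a ∧ s₀ < 0 ∧ ∀ s ∈ Set.Ico s₀ 0,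
      ∃ x₀ ∈ Metric.ball (0 : EuclideanSpace ℝ (Fin 3)) 1,
        (∀ y ∈ Metric.ball x₀ (ρ * Real.sqrt (-s)), a / Real.sqrt (-s) ≤ ‖v s y‖) ∧
        γ ≤ ∫ y in Metric.ball x₀ (ρ * Real.sqrt (-s)), ‖v s y‖ ^ 3 :=
  lThreeConcentration_of_floorIn hv ((floorIn_one_iff v).2 hfl)

/-! ## §B  THE FLOOR IS CARRIED INTO THE APEX (multiscale floor), energy class

The uniform-local-energy class `(M, E)` is NOT scale-invariant, but it is scale-STABLE: the parabolic zoom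
`v_λ(t,x) = λ v(λ²t, λx)`, `0 < λ ≤ 1`, has Type-I constant `M` (KNSS gauge, landed `IsTypeIAncientMild.nsRescale`) and
unit-scale energy `≤ E/λ` (`localEnergyBound_nsRescale`), and the apex singularity is scale-invariant.  Hence the §6
floor theorem of `Lines/quiet_core.lean` (`localRateFloor_of_singularAt_L2`, entering BY STATEMENT as
`EnergyClassFloorTheorem` — crux workfiles are not importable), applied to `v_λ` and unscaled, puts a floor point in
EVERY ball `B(0,λ)` around the apex: `multiscaleFloor_of_energyClassFloorTheorem`.  With §A this is critical
concentration on parabolic balls within any prescribed distance `λ` of the apex (constants depending on `λ`). -/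

/-- Verbatim copy of `Lines/quiet_core.lean` §6 `LocalEnergyBound` (uniform unit-scale energy on `(−1,0)`). -/
def LocalEnergyBound' (E : ℝ) (v : ℝ → EuclideanSpace ℝ (Fin 3) → EuclideanSpace ℝ (Fin 3)) : Prop :=
  ∀ x₀ : EuclideanSpace ℝ (Fin 3), ∀ t ∈ Set.Ioo (-1 : ℝ) 0,
    ∫⁻ y in Metric.ball x₀ 1, ENNReal.ofReal (‖v t y‖ ^ 2) ≤ ENNReal.ofReal E

/-- The §6 floor theorem `localRateFloor_of_singularAt_L2 : IsTypeIAncientMild M v → LocalEnergyBound E v →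
SingularAt v 0 → LocalRateFloor v` of `Lines/quiet_core.lean` (PROVED there, std axioms), BY STATEMENT. -/
def EnergyClassFloorTheorem : Prop :=
  ∀ (M E : ℝ) (w : ℝ → EuclideanSpace ℝ (Fin 3) → EuclideanSpace ℝ (Fin 3)),
    IsTypeIAncientMild M w → LocalEnergyBound' E w → SingularAt w 0 → LocalRateFloor w

/-- The apex singularity is scale-invariant. -/
theorem singularAt_zero_nsRescale {v : ℝ → EuclideanSpace ℝ (Fin 3) → EuclideanSpace ℝ (Fin 3)}
    (hsing : SingularAt v 0) {lam : ℝ} (hlam : 0 < lam) : SingularAt (nsRescale lam v) 0 := by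
  intro r hr A
  obtain ⟨t, ht, y, hy, hA⟩ := hsing (lam * r) (mul_pos hlam hr) (A / lam)
  refine ⟨t / lam ^ 2, ⟨?_, ?_⟩, lam⁻¹ • y, ?_, ?_⟩
  · rw [lt_div_iff₀ (pow_pos hlam 2)]; nlinarith [ht.1]
  · exact div_neg_of_neg_of_pos ht.2 (pow_pos hlam 2)
  · rw [Metric.mem_ball, dist_zero_right, norm_smul, norm_inv, Real.norm_of_nonneg hlam.le]
    rw [Metric.mem_ball, dist_zero_right] at hy
    rw [inv_mul_lt_iff₀ hlam]; linarith
  · rw [nsRescale_apply, mul_div_cancel₀ _ (pow_pos hlam 2).ne', smul_inv_smul₀ hlam.ne', norm_smul,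
      Real.norm_of_nonneg hlam.le]
    rwa [div_lt_iff₀' hlam] at hA

/-- **Scale-stability of the energy class**: the zoom `v_λ`, `0 < λ ≤ 1`, has unit-scale energy `≤ E/λ`. -/
theorem localEnergyBound_nsRescale {E : ℝ} {M : ℝ}
    {v : ℝ → EuclideanSpace ℝ (Fin 3) → EuclideanSpace ℝ (Fin 3)} (hv : IsTypeIAncientMild M v)
    (hE : LocalEnergyBound' E v) {lam : ℝ} (hlam : 0 < lam) (hlam1 : lam ≤ 1) :
    LocalEnergyBound' (E / lam) (nsRescale lam v) := by
  intro x₀ t ht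
  have hl2 : 0 < lam ^ 2 := pow_pos hlam 2
  have ht' : lam ^ 2 * t ∈ Set.Ioo (-1 : ℝ) 0 := by
    refine ⟨?_, mul_neg_of_pos_of_neg hl2 ht.2⟩
    have : lam ^ 2 ≤ 1 := by nlinarith
    nlinarith [ht.1]
  have hneg : lam ^ 2 * t < 0 := ht'.2
  -- the integrand after the zoom, as a function of `z = λ y`
  set g : EuclideanSpace ℝ (Fin 3) → ℝ≥0∞ := fun z => ENNReal.ofReal (‖v (lam ^ 2 * t) z‖ ^ 2) with hg
  have hgm : Measurable g :=
    ((hv.continuous_slice hneg).norm.pow 2).measurable.ennreal_ofReal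
  set G : EuclideanSpace ℝ (Fin 3) → ℝ≥0∞ := (Metric.ball (lam • x₀) lam).indicator g with hG
  have hGm : Measurable G := hgm.indicator measurableSet_ball
  -- pointwise: `1_{B(x₀,1)}(y) ‖v_λ t y‖² = λ² · G(λ y)`
  have hpt : ∀ y : EuclideanSpace ℝ (Fin 3),
      (Metric.ball x₀ 1).indicator (fun y => ENNReal.ofReal (‖nsRescale lam v t y‖ ^ 2)) y =
        ENNReal.ofReal (lam ^ 2) * G (lam • y) := by
    intro y
    have hmem : y ∈ Metric.ball x₀ 1 ↔ lam • y ∈ Metric.ball (lam • x₀) lam := by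
      rw [Metric.mem_ball, Metric.mem_ball, dist_smul₀, Real.norm_of_nonneg hlam.le]
      constructor
      · intro h; nlinarith
      · intro h; nlinarith
    by_cases hy : y ∈ Metric.ball x₀ 1
    · rw [Set.indicator_of_mem hy, hG, Set.indicator_of_mem (hmem.1 hy), hg]
      simp only [nsRescale_apply, norm_smul, Real.norm_of_nonneg hlam.le, mul_pow]
      rw [ENNReal.ofReal_mul (by positivity)]
    · rw [Set.indicator_of_notMem hy, hG, Set.indicator_of_notMem (fun h => hy (hmem.2 h)), mul_zero]
  have hmap : Measure.map (fun y : EuclideanSpace ℝ (Fin 3) => lam • y) volume =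
      ENNReal.ofReal (|(lam ^ Module.finrank ℝ (EuclideanSpace ℝ (Fin 3)))⁻¹|) • volume :=
    Measure.map_addHaar_smul volume hlam.ne'
  calc ∫⁻ y in Metric.ball x₀ 1, ENNReal.ofReal (‖nsRescale lam v t y‖ ^ 2)
      = ∫⁻ y, (Metric.ball x₀ 1).indicator (fun y => ENNReal.ofReal (‖nsRescale lam v t y‖ ^ 2)) y := by
        rw [lintegral_indicator measurableSet_ball]
    _ = ∫⁻ y, ENNReal.ofReal (lam ^ 2) * G (lam • y) := by
        refine lintegral_congr fun y => hpt y
    _ = ENNReal.ofReal (lam ^ 2) * ∫⁻ y, G (lam • y) := by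
        rw [lintegral_const_mul' _ _ ENNReal.ofReal_ne_top]
    _ = ENNReal.ofReal (lam ^ 2) * ∫⁻ z, G z ∂(Measure.map (fun y : EuclideanSpace ℝ (Fin 3) => lam • y) volume) := by
        rw [lintegral_map hGm (measurable_const_smul lam)]
    _ = ENNReal.ofReal (lam ^ 2) * (ENNReal.ofReal ((lam ^ 3)⁻¹) * ∫⁻ z, G z) := by
        rw [hmap, lintegral_smul_measure, finrank_euclideanSpace_fin,
          abs_of_nonneg (inv_nonneg.2 (pow_nonneg hlam.le 3)), smul_eq_mul]
    _ = ENNReal.ofReal lam⁻¹ * ∫⁻ z in Metric.ball (lam • x₀) lam, g z := by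
        have hsc : ENNReal.ofReal (lam ^ 2) * ENNReal.ofReal ((lam ^ 3)⁻¹) = ENNReal.ofReal lam⁻¹ := by
          rw [← ENNReal.ofReal_mul (by positivity)]
          congr 1
          field_simp
        rw [← mul_assoc, hsc, hG, lintegral_indicator measurableSet_ball]
    _ ≤ ENNReal.ofReal lam⁻¹ * ∫⁻ z in Metric.ball (lam • x₀) 1, g z :=
        mul_le_mul' le_rfl (lintegral_mono_set (Metric.ball_subset_ball hlam1))
    _ ≤ ENNReal.ofReal lam⁻¹ * ENNReal.ofReal E :=
        mul_le_mul' le_rfl (hE (lam • x₀) (lam ^ 2 * t) ht')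
    _ = ENNReal.ofReal (E / lam) := by
        rw [← ENNReal.ofReal_mul (inv_nonneg.2 hlam.le), div_eq_inv_mul]

/-- Unscaling a unit-ball floor of the zoom `v_λ` gives a floor of `v` in `B(0,λ)` (same constant). -/
theorem floorIn_of_localRateFloor_nsRescale {v : ℝ → EuclideanSpace ℝ (Fin 3) → EuclideanSpace ℝ (Fin 3)}
    {lam : ℝ} (hlam : 0 < lam) (h : LocalRateFloor (nsRescale lam v)) : FloorIn lam v := by
  obtain ⟨c, s₀, hc, hs₀, hf⟩ := h
  have hl2 : 0 < lam ^ 2 := pow_pos hlam 2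
  refine ⟨c, lam ^ 2 * s₀, hc, mul_neg_of_pos_of_neg hl2 hs₀, fun s hs => ?_⟩
  have hs' : s / lam ^ 2 ∈ Set.Ico s₀ 0 := by
    refine ⟨?_, div_neg_of_neg_of_pos hs.2 hl2⟩
    rw [le_div_iff₀ hl2]; linarith [hs.1]
  obtain ⟨x, hx, hcx⟩ := hf (s / lam ^ 2) hs'
  refine ⟨lam • x, ?_, ?_⟩
  · rw [Metric.mem_ball, dist_zero_right, norm_smul, Real.norm_of_nonneg hlam.le]
    rw [Metric.mem_ball, dist_zero_right] at hx
    nlinarith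
  · rw [nsRescale_apply, mul_div_cancel₀ _ hl2.ne', norm_smul, Real.norm_of_nonneg hlam.le] at hcx
    have hσ : 0 < -s := neg_pos.2 hs.2
    have hsq : Real.sqrt (-(s / lam ^ 2)) = Real.sqrt (-s) / lam := by
      rw [show -(s / lam ^ 2) = (-s) / lam ^ 2 by ring, Real.sqrt_div' _ (pow_nonneg hlam.le 2), Real.sqrt_sq hlam.le]
    rw [hsq, div_div_eq_mul_div] at hcx
    -- `c·λ/√(−s) ≤ λ‖v s (λx)‖`
    have hq0 : 0 < Real.sqrt (-s) := Real.sqrt_pos.2 hσ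
    rw [mul_comm c lam, mul_div_assoc] at hcx
    exact le_of_mul_le_mul_left hcx hlam

/-- **THE FLOOR IS CARRIED INTO THE APEX (energy class).**  Granted the §6 floor theorem of `Lines/quiet_core.lean`
(`EnergyClassFloorTheorem`, proved there): a Type-I ancient mild field with uniform unit-scale energy which is singular at
the apex has, for EVERY `λ ∈ (0,1]`, a rate floor carried by the ball `B(0,λ)`:
`∃ c_λ > 0, s_λ < 0, ∀ s ∈ [s_λ,0), ∃ x ∈ B(0,λ), ‖v(s,x)‖ ≥ c_λ/√(−s)`.  (Zoom by `λ`, apply the theorem in the class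
`(M, E/λ)`, unscale.)  In particular every THIN singular object of the tree has floors at all scales around its apex. -/
theorem multiscaleFloor_of_energyClassFloorTheorem (hThm : EnergyClassFloorTheorem) {M E : ℝ}
    {v : ℝ → EuclideanSpace ℝ (Fin 3) → EuclideanSpace ℝ (Fin 3)} (hv : IsTypeIAncientMild M v)
    (hE : LocalEnergyBound' E v) (hsing : SingularAt v 0) :
    ∀ lam ∈ Set.Ioc (0 : ℝ) 1, FloorIn lam v := fun lam hlam =>
  floorIn_of_localRateFloor_nsRescale hlam.1
    (hThm M (E / lam) (nsRescale lam v) (hv.nsRescale hlam.1) (localEnergyBound_nsRescale hv hE hlam.1 hlam.2)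
      (singularAt_zero_nsRescale hsing hlam.1))

/-! ## §C  THE FLOOR IS CARRIED INTO THE APEX, log-cube class

The log-cube class is scale-STABLE with a logarithmic loss: the zoom `v_λ`, `0 < λ ≤ 1`, of a field with log-cube budget
constant `B` has log-cube budget constant `B(1 + 2 log(1/λ))` (`envelopeCubeBudget_nsRescale`: the localised critical
norm is scale-invariant, `‖1_{B(R)} v_λ(s)‖₃ = ‖1_{B(λR)} v(λ²s)‖₃ ≤ ‖1_{B(R)} v(λ²s)‖₃`, and the time window shifts
`ε ↦ λ²ε`, i.e. `log(1/ε) ↦ log(1/ε) + 2 log(1/λ)`).  Hence §5's floor theorem `localRateFloorLogCube` of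
`Lines/quiet_core.lean` (BY STATEMENT: `LocalRateFloorLogCube'`) gives floors in every `B(0,λ)`. -/

/-- Verbatim copy of `LocalRateFloorLogCube` (`Lines/quiet_collar.lean` v1.6 / `Lines/quiet_core.lean` §2; PROVED in
`Lines/quiet_core.lean` §5 as `localRateFloorLogCube`, std axioms), BY STATEMENT. -/
def LocalRateFloorLogCube' : Prop :=
  ∀ (M : ℝ) (v : ℝ → EuclideanSpace ℝ (Fin 3) → EuclideanSpace ℝ (Fin 3)),
    IsTypeIAncientMild M v → EnvelopeCubeBudget v → SingularAt v 0 → LocalRateFloor v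

/-- **Scale-invariance of the localised critical norm**: `‖1_{B(R)} v_λ(s)‖₃ = ‖1_{B(λR)} v(λ²s)‖₃` (`λ > 0`). -/
theorem eLpNorm_indicator_ball_nsRescale (v : ℝ → EuclideanSpace ℝ (Fin 3) → EuclideanSpace ℝ (Fin 3))
    {lam : ℝ} (hlam : 0 < lam) (R s : ℝ) :
    eLpNorm ((Metric.ball (0 : EuclideanSpace ℝ (Fin 3)) R).indicator (nsRescale lam v s)) 3 volume =
      eLpNorm ((Metric.ball (0 : EuclideanSpace ℝ (Fin 3)) (lam * R)).indicator (v (lam ^ 2 * s))) 3 volume := by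
  have hfun : (Metric.ball (0 : EuclideanSpace ℝ (Fin 3)) R).indicator (nsRescale lam v s) =
      nsRescaleData lam ((Metric.ball (0 : EuclideanSpace ℝ (Fin 3)) (lam * R)).indicator (v (lam ^ 2 * s))) := by
    funext y
    have hmem : y ∈ Metric.ball (0 : EuclideanSpace ℝ (Fin 3)) R ↔
        lam • y ∈ Metric.ball (0 : EuclideanSpace ℝ (Fin 3)) (lam * R) := by
      rw [Metric.mem_ball, Metric.mem_ball, dist_zero_right, dist_zero_right, norm_smul,
        Real.norm_of_nonneg hlam.le]
      constructor
      · intro h; nlinarith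
      · intro h; nlinarith
    by_cases hy : y ∈ Metric.ball (0 : EuclideanSpace ℝ (Fin 3)) R
    · rw [Set.indicator_of_mem hy, nsRescale_apply]
      show _ = lam • (Metric.ball (0 : EuclideanSpace ℝ (Fin 3)) (lam * R)).indicator (v (lam ^ 2 * s)) (lam • y)
      rw [Set.indicator_of_mem (hmem.1 hy)]
    · rw [Set.indicator_of_notMem hy]
      show (0 : EuclideanSpace ℝ (Fin 3)) =
        lam • (Metric.ball (0 : EuclideanSpace ℝ (Fin 3)) (lam * R)).indicator (v (lam ^ 2 * s)) (lam • y)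
      rw [Set.indicator_of_notMem (fun h => hy (hmem.2 h)), smul_zero]
  rw [hfun, eLpNorm_nsRescaleData_of_ne_zero 3 _ hlam.ne', finrank_euclideanSpace_fin]
  have hsc : ‖lam‖ₑ * ENNReal.ofReal |(lam ^ 3)⁻¹| ^ (1 / (3 : ℝ≥0∞)).toReal = 1 := by
    rw [abs_of_nonneg (inv_nonneg.2 (pow_nonneg hlam.le 3)), ENNReal.toReal_div, ENNReal.toReal_one,
      show ((3 : ℝ≥0∞)).toReal = 3 by norm_num,
      ENNReal.ofReal_rpow_of_nonneg (inv_nonneg.2 (pow_nonneg hlam.le 3)) (by norm_num),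
      Real.enorm_eq_ofReal hlam.le, ← ENNReal.ofReal_mul hlam.le]
    have : (lam ^ 3)⁻¹ ^ (1 / 3 : ℝ) = lam⁻¹ := by
      rw [Real.inv_rpow (pow_nonneg hlam.le 3), show (1 / 3 : ℝ) = ((3 : ℕ) : ℝ)⁻¹ by norm_num,
        Real.pow_rpow_inv_natCast hlam.le (by norm_num)]
    rw [this, mul_inv_cancel₀ hlam.ne', ENNReal.ofReal_one]
  rw [hsc, one_mul]

/-- **Scale-stability of the log-cube class** (logarithmic loss): if `v` has log-cube budget constant `B`, the zoom
`v_λ`, `0 < λ ≤ 1`, has log-cube budget constant `B(1 + 2 log(1/λ))`. -/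
theorem envelopeCubeBudget_nsRescale {v : ℝ → EuclideanSpace ℝ (Fin 3) → EuclideanSpace ℝ (Fin 3)}
    (hB : EnvelopeCubeBudget v) {lam : ℝ} (hlam : 0 < lam) (hlam1 : lam ≤ 1) :
    EnvelopeCubeBudget (nsRescale lam v) := by
  obtain ⟨B, hB0, hbud⟩ := hB
  have hl2 : 0 < lam ^ 2 := pow_pos hlam 2
  have hl21 : lam ^ 2 ≤ 1 := by nlinarith
  have hL : 0 ≤ Real.log (1 / lam) := Real.log_nonneg (by rw [le_div_iff₀ hlam]; linarith)
  refine ⟨B * (1 + 2 * Real.log (1 / lam)), mul_nonneg hB0 (by linarith), fun R hR ε hε => ?_⟩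
  have hε' : lam ^ 2 * ε ∈ Set.Ioc (0 : ℝ) 1 :=
    ⟨mul_pos hl2 hε.1, by nlinarith [hε.2, hε.1]⟩
  obtain ⟨b, hb0, hb3, hsl⟩ := hbud R hR (lam ^ 2 * ε) hε'
  refine ⟨b, hb0, hb3.trans ?_, fun s hs => ?_⟩
  · -- `1 + log R + log(1/(λ²ε)) ≤ (1 + 2 log(1/λ)) (1 + log R + log(1/ε))`
    have hlogR : 0 ≤ Real.log R := Real.log_nonneg (by linarith)
    have hlogε : 0 ≤ Real.log (1 / ε) := Real.log_nonneg (by rw [le_div_iff₀ hε.1]; linarith [hε.2])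
    have hsplit : Real.log (1 / (lam ^ 2 * ε)) = Real.log (1 / ε) + 2 * Real.log (1 / lam) := by
      have hε0 : (1 / ε) ≠ 0 := (one_div_pos.2 hε.1).ne'
      have hl0 : (1 / lam) ^ 2 ≠ 0 := pow_ne_zero 2 (one_div_pos.2 hlam).ne'
      rw [show 1 / (lam ^ 2 * ε) = (1 / ε) * (1 / lam) ^ 2 by field_simp, Real.log_mul hε0 hl0, Real.log_pow]
      push_cast; ring
    rw [hsplit]
    have hprod : B * (1 + Real.log R + (Real.log (1 / ε) + 2 * Real.log (1 / lam))) ≤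
        B * (1 + 2 * Real.log (1 / lam)) * (1 + Real.log R + Real.log (1 / ε)) := by
      rw [mul_assoc]
      refine mul_le_mul_of_nonneg_left ?_ hB0
      nlinarith
    exact hprod
  · have hs' : lam ^ 2 * s ∈ Set.Icc (-1 : ℝ) (-(lam ^ 2 * ε)) := by
      refine ⟨?_, by nlinarith [hs.2]⟩
      nlinarith [hs.1]
    rw [eLpNorm_indicator_ball_nsRescale v hlam R s]
    refine le_trans (eLpNorm_mono fun y => ?_) (hsl (lam ^ 2 * s) hs')
    exact norm_indicator_le_of_subset (Metric.ball_subset_ball (by nlinarith)) _ _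

/-- **THE FLOOR IS CARRIED INTO THE APEX (log-cube class).**  Granted §5's floor theorem of `Lines/quiet_core.lean`
(`LocalRateFloorLogCube'`, proved there): a log-cube Type-I ancient mild field singular at the apex has, for EVERY
`λ ∈ (0,1]`, a rate floor carried by `B(0,λ)` (zoom, apply the theorem in the class `(M, B(1+2log(1/λ)))`, unscale). -/
theorem multiscaleFloor_of_localRateFloorLogCube (hThm : LocalRateFloorLogCube') {M : ℝ}
    {v : ℝ → EuclideanSpace ℝ (Fin 3) → EuclideanSpace ℝ (Fin 3)} (hv : IsTypeIAncientMild M v)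
    (hB : EnvelopeCubeBudget v) (hsing : SingularAt v 0) :
    ∀ lam ∈ Set.Ioc (0 : ℝ) 1, FloorIn lam v := fun lam hlam =>
  floorIn_of_localRateFloor_nsRescale hlam.1
    (hThm M (nsRescale lam v) (hv.nsRescale hlam.1) (envelopeCubeBudget_nsRescale hB hlam.1 hlam.2)
      (singularAt_zero_nsRescale hsing hlam.1))

/-! ## §D  APEX CONCENTRATION (both classes): floors and parabolic plateaus within any distance `λ` of the apex -/

/-- **APEX CONCENTRATION, energy / thin class** (granted the §6 floor theorem of the main file): for every `λ ∈ (0,1]`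
there are `γ, ρ, a > 0`, `s₀ < 0` such that at every `s ∈ [s₀,0)` some parabolic ball `B(x₀, ρ√(−s))` with
`‖x₀‖ < λ` carries the plateau `‖v(s)‖ ≥ a/√(−s)` and critical mass `∫ ‖v(s)‖³ ≥ γ`. -/
theorem apexConcentration_energyClass (hThm : EnergyClassFloorTheorem) {M E : ℝ}
    {v : ℝ → EuclideanSpace ℝ (Fin 3) → EuclideanSpace ℝ (Fin 3)} (hv : IsTypeIAncientMild M v)
    (hE : LocalEnergyBound' E v) (hsing : SingularAt v 0) {lam : ℝ} (hlam : lam ∈ Set.Ioc (0 : ℝ) 1) :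
    ∃ γ ρ a s₀ : ℝ, 0 < γ ∧ 0 < ρ ∧ ρ ≤ 1 ∧ 0 < a ∧ s₀ < 0 ∧ ∀ s ∈ Set.Ico s₀ 0,
      ∃ x₀ ∈ Metric.ball (0 : EuclideanSpace ℝ (Fin 3)) lam,
        (∀ y ∈ Metric.ball x₀ (ρ * Real.sqrt (-s)), a / Real.sqrt (-s) ≤ ‖v s y‖) ∧
        γ ≤ ∫ y in Metric.ball x₀ (ρ * Real.sqrt (-s)), ‖v s y‖ ^ 3 :=
  lThreeConcentration_of_floorIn hv (multiscaleFloor_of_energyClassFloorTheorem hThm hv hE hsing lam hlam)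

/-- **APEX CONCENTRATION, log-cube class** (granted §5's floor theorem of the main file). -/
theorem apexConcentration_logCube (hThm : LocalRateFloorLogCube') {M : ℝ}
    {v : ℝ → EuclideanSpace ℝ (Fin 3) → EuclideanSpace ℝ (Fin 3)} (hv : IsTypeIAncientMild M v)
    (hB : EnvelopeCubeBudget v) (hsing : SingularAt v 0) {lam : ℝ} (hlam : lam ∈ Set.Ioc (0 : ℝ) 1) :
    ∃ γ ρ a s₀ : ℝ, 0 < γ ∧ 0 < ρ ∧ ρ ≤ 1 ∧ 0 < a ∧ s₀ < 0 ∧ ∀ s ∈ Set.Ico s₀ 0,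
      ∃ x₀ ∈ Metric.ball (0 : EuclideanSpace ℝ (Fin 3)) lam,
        (∀ y ∈ Metric.ball x₀ (ρ * Real.sqrt (-s)), a / Real.sqrt (-s) ≤ ‖v s y‖) ∧
        γ ≤ ∫ y in Metric.ball x₀ (ρ * Real.sqrt (-s)), ‖v s y‖ ^ 3 :=
  lThreeConcentration_of_floorIn hv (multiscaleFloor_of_localRateFloorLogCube hThm hv hB hsing lam hlam)

/-! ## §E  UNIFORM CONSTANTS: the floor level `c₀(M)` is class-uniform (main file §7, v1.8), hence the apex floors at
every scale carry the SAME level and the apex concentration constants `γ, ρ, a` depend on `M` ONLY — only the onset time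
depends on `λ`.  Reading: critical mass `γ(M)` concentrates on parabolic balls whose centres tend to the apex. -/

/-- Main file §7 `uniformFloor_L2` (PROVED there, std axioms), BY STATEMENT. -/
def UniformFloorTheoremL2 : Prop :=
  ∀ M : ℝ, ∃ c : ℝ, 0 < c ∧
    ∀ (E : ℝ) (v : ℝ → EuclideanSpace ℝ (Fin 3) → EuclideanSpace ℝ (Fin 3)),
      IsTypeIAncientMild M v → LocalEnergyBound' E v → SingularAt v 0 →
      ∃ s₀ : ℝ, s₀ < 0 ∧ ∀ s ∈ Set.Ico s₀ 0,
        ∃ x ∈ Metric.ball (0 : EuclideanSpace ℝ (Fin 3)) 1, c / Real.sqrt (-s) ≤ ‖v s x‖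

/-- Main file §7 `uniformFloor_logCube` (PROVED there, std axioms), BY STATEMENT. -/
def UniformFloorTheoremLogCube : Prop :=
  ∀ M : ℝ, ∃ c : ℝ, 0 < c ∧
    ∀ v : ℝ → EuclideanSpace ℝ (Fin 3) → EuclideanSpace ℝ (Fin 3),
      IsTypeIAncientMild M v → EnvelopeCubeBudget v → SingularAt v 0 →
      ∃ s₀ : ℝ, s₀ < 0 ∧ ∀ s ∈ Set.Ico s₀ 0,
        ∃ x ∈ Metric.ball (0 : EuclideanSpace ℝ (Fin 3)) 1, c / Real.sqrt (-s) ≤ ‖v s x‖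

/-- Unscaling with the level kept: a unit-ball floor of `v_λ` at level `c` from `s₀` on is a `B(0,λ)`-floor of `v` at the
SAME level from `λ²s₀` on. -/
theorem floorInWith_of_nsRescale {v : ℝ → EuclideanSpace ℝ (Fin 3) → EuclideanSpace ℝ (Fin 3)} {lam c s₀ : ℝ}
    (hlam : 0 < lam)
    (hf : ∀ s ∈ Set.Ico s₀ 0, ∃ x ∈ Metric.ball (0 : EuclideanSpace ℝ (Fin 3)) 1,
      c / Real.sqrt (-s) ≤ ‖nsRescale lam v s x‖) :
    ∀ s ∈ Set.Ico (lam ^ 2 * s₀) 0, ∃ x ∈ Metric.ball (0 : EuclideanSpace ℝ (Fin 3)) lam,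
      c / Real.sqrt (-s) ≤ ‖v s x‖ := by
  intro s hs
  have hl2 : 0 < lam ^ 2 := pow_pos hlam 2
  have hs' : s / lam ^ 2 ∈ Set.Ico s₀ 0 := by
    refine ⟨?_, div_neg_of_neg_of_pos hs.2 hl2⟩
    rw [le_div_iff₀ hl2]; linarith [hs.1]
  obtain ⟨x, hx, hcx⟩ := hf (s / lam ^ 2) hs'
  refine ⟨lam • x, ?_, ?_⟩
  · rw [Metric.mem_ball, dist_zero_right, norm_smul, Real.norm_of_nonneg hlam.le]
    rw [Metric.mem_ball, dist_zero_right] at hx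
    nlinarith
  · rw [nsRescale_apply, mul_div_cancel₀ _ hl2.ne', norm_smul, Real.norm_of_nonneg hlam.le] at hcx
    have hsq : Real.sqrt (-(s / lam ^ 2)) = Real.sqrt (-s) / lam := by
      rw [show -(s / lam ^ 2) = (-s) / lam ^ 2 by ring, Real.sqrt_div' _ (pow_nonneg hlam.le 2),
        Real.sqrt_sq hlam.le]
    rw [hsq, div_div_eq_mul_div, mul_comm c lam, mul_div_assoc] at hcx
    exact le_of_mul_le_mul_left hcx hlam

/-- **APEX FLOORS AT EVERY SCALE WITH A UNIFORM LEVEL, energy class**: `∃ c = c₀(M) > 0, ∀ λ ∈ (0,1], ∃ s_λ < 0,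
∀ s ∈ [s_λ, 0), ∃ x ∈ B(0,λ), ‖v(s,x)‖ ≥ c/√(−s)` — the floor points may be taken tending to the apex, at a fixed level. -/
theorem uniformApexFloor_energyClass (hThm : UniformFloorTheoremL2) {M E : ℝ}
    {v : ℝ → EuclideanSpace ℝ (Fin 3) → EuclideanSpace ℝ (Fin 3)} (hv : IsTypeIAncientMild M v)
    (hE : LocalEnergyBound' E v) (hsing : SingularAt v 0) :
    ∃ c : ℝ, 0 < c ∧ ∀ lam ∈ Set.Ioc (0 : ℝ) 1, ∃ s₀ : ℝ, s₀ < 0 ∧ ∀ s ∈ Set.Ico s₀ 0,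
      ∃ x ∈ Metric.ball (0 : EuclideanSpace ℝ (Fin 3)) lam, c / Real.sqrt (-s) ≤ ‖v s x‖ := by
  obtain ⟨c, hc, H⟩ := hThm M
  refine ⟨c, hc, fun lam hlam => ?_⟩
  obtain ⟨s₀, hs₀, hf⟩ := H (E / lam) (nsRescale lam v) (hv.nsRescale hlam.1)
    (localEnergyBound_nsRescale hv hE hlam.1 hlam.2) (singularAt_zero_nsRescale hsing hlam.1)
  exact ⟨lam ^ 2 * s₀, mul_neg_of_pos_of_neg (pow_pos hlam.1 2) hs₀, floorInWith_of_nsRescale hlam.1 hf⟩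

/-- **APEX FLOORS AT EVERY SCALE WITH A UNIFORM LEVEL, log-cube class.** -/
theorem uniformApexFloor_logCube (hThm : UniformFloorTheoremLogCube) {M : ℝ}
    {v : ℝ → EuclideanSpace ℝ (Fin 3) → EuclideanSpace ℝ (Fin 3)} (hv : IsTypeIAncientMild M v)
    (hB : EnvelopeCubeBudget v) (hsing : SingularAt v 0) :
    ∃ c : ℝ, 0 < c ∧ ∀ lam ∈ Set.Ioc (0 : ℝ) 1, ∃ s₀ : ℝ, s₀ < 0 ∧ ∀ s ∈ Set.Ico s₀ 0,
      ∃ x ∈ Metric.ball (0 : EuclideanSpace ℝ (Fin 3)) lam, c / Real.sqrt (-s) ≤ ‖v s x‖ := by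
  obtain ⟨c, hc, H⟩ := hThm M
  refine ⟨c, hc, fun lam hlam => ?_⟩
  obtain ⟨s₀, hs₀, hf⟩ := H (nsRescale lam v) (hv.nsRescale hlam.1)
    (envelopeCubeBudget_nsRescale hB hlam.1 hlam.2) (singularAt_zero_nsRescale hsing hlam.1)
  exact ⟨lam ^ 2 * s₀, mul_neg_of_pos_of_neg (pow_pos hlam.1 2) hs₀, floorInWith_of_nsRescale hlam.1 hf⟩

/-- **UNIFORM APEX CONCENTRATION** (from uniform apex floors; class-generic packaging): if the floors at every scale carry
a common level `c`, then with `γ, ρ, a` depending on `M` and `c` ONLY, for every `λ ∈ (0,1]` and all late `s` a parabolic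
ball `B(x₀, ρ√(−s))` with `‖x₀‖ < λ` carries the plateau `a/√(−s)` and critical mass `≥ γ`. -/
theorem uniformApexConcentration_of_floors {M : ℝ}
    {v : ℝ → EuclideanSpace ℝ (Fin 3) → EuclideanSpace ℝ (Fin 3)} (hv : IsTypeIAncientMild M v) {c : ℝ}
    (hc : 0 < c)
    (hfl : ∀ lam ∈ Set.Ioc (0 : ℝ) 1, ∃ s₀ : ℝ, s₀ < 0 ∧ ∀ s ∈ Set.Ico s₀ 0,
      ∃ x ∈ Metric.ball (0 : EuclideanSpace ℝ (Fin 3)) lam, c / Real.sqrt (-s) ≤ ‖v s x‖) :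
    ∃ γ ρ a : ℝ, 0 < γ ∧ 0 < ρ ∧ ρ ≤ 1 ∧ 0 < a ∧ ∀ lam ∈ Set.Ioc (0 : ℝ) 1, ∃ s₀ : ℝ, s₀ < 0 ∧
      ∀ s ∈ Set.Ico s₀ 0, ∃ x₀ ∈ Metric.ball (0 : EuclideanSpace ℝ (Fin 3)) lam,
        (∀ y ∈ Metric.ball x₀ (ρ * Real.sqrt (-s)), a / Real.sqrt (-s) ≤ ‖v s y‖) ∧
        γ ≤ ∫ y in Metric.ball x₀ (ρ * Real.sqrt (-s)), ‖v s y‖ ^ 3 := by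
  obtain ⟨K, hK, hconc⟩ := concentration_of_floorPoint M
  have hρ0 : 0 < min 1 (c / (2 * K)) := lt_min one_pos (by positivity)
  have hB : 0 < (volume (Metric.ball (0 : EuclideanSpace ℝ (Fin 3)) 1)).toReal :=
    ENNReal.toReal_pos (measure_ball_pos volume _ one_pos).ne' measure_ball_lt_top.ne
  refine ⟨(volume (Metric.ball (0 : EuclideanSpace ℝ (Fin 3)) 1)).toReal * (min 1 (c / (2 * K)) * c / 2) ^ 3,
    min 1 (c / (2 * K)), c / 2, by positivity, hρ0, min_le_left _ _, by positivity, fun lam hlam => ?_⟩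
  obtain ⟨s₀, hs₀, hf⟩ := hfl lam hlam
  refine ⟨s₀, hs₀, fun s hs => ?_⟩
  obtain ⟨x₀, hx₀, hfx⟩ := hf s hs
  obtain ⟨hP, hI⟩ := hconc v hv c hc s hs.2 x₀ hfx
  refine ⟨x₀, hx₀, fun y hy => ?_, hI⟩
  rw [div_div]; exact hP y hy

/-- **UNIFORM APEX CONCENTRATION, energy / thin class** (granted main file §7): `γ(M), ρ(M), a(M)`; centres `→` apex. -/
theorem uniformApexConcentration_energyClass (hThm : UniformFloorTheoremL2) {M E : ℝ}
    {v : ℝ → EuclideanSpace ℝ (Fin 3) → EuclideanSpace ℝ (Fin 3)} (hv : IsTypeIAncientMild M v)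
    (hE : LocalEnergyBound' E v) (hsing : SingularAt v 0) :
    ∃ γ ρ a : ℝ, 0 < γ ∧ 0 < ρ ∧ ρ ≤ 1 ∧ 0 < a ∧ ∀ lam ∈ Set.Ioc (0 : ℝ) 1, ∃ s₀ : ℝ, s₀ < 0 ∧
      ∀ s ∈ Set.Ico s₀ 0, ∃ x₀ ∈ Metric.ball (0 : EuclideanSpace ℝ (Fin 3)) lam,
        (∀ y ∈ Metric.ball x₀ (ρ * Real.sqrt (-s)), a / Real.sqrt (-s) ≤ ‖v s y‖) ∧
        γ ≤ ∫ y in Metric.ball x₀ (ρ * Real.sqrt (-s)), ‖v s y‖ ^ 3 := by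
  obtain ⟨c, hc, hfl⟩ := uniformApexFloor_energyClass hThm hv hE hsing
  exact uniformApexConcentration_of_floors hv hc hfl

/-- **UNIFORM APEX CONCENTRATION, log-cube class** (granted main file §7). -/
theorem uniformApexConcentration_logCube (hThm : UniformFloorTheoremLogCube) {M : ℝ}
    {v : ℝ → EuclideanSpace ℝ (Fin 3) → EuclideanSpace ℝ (Fin 3)} (hv : IsTypeIAncientMild M v)
    (hB : EnvelopeCubeBudget v) (hsing : SingularAt v 0) :
    ∃ γ ρ a : ℝ, 0 < γ ∧ 0 < ρ ∧ ρ ≤ 1 ∧ 0 < a ∧ ∀ lam ∈ Set.Ioc (0 : ℝ) 1, ∃ s₀ : ℝ, s₀ < 0 ∧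
      ∀ s ∈ Set.Ico s₀ 0, ∃ x₀ ∈ Metric.ball (0 : EuclideanSpace ℝ (Fin 3)) lam,
        (∀ y ∈ Metric.ball x₀ (ρ * Real.sqrt (-s)), a / Real.sqrt (-s) ≤ ‖v s y‖) ∧
        γ ≤ ∫ y in Metric.ball x₀ (ρ * Real.sqrt (-s)), ‖v s y‖ ^ 3 := by
  obtain ⟨c, hc, hfl⟩ := uniformApexFloor_logCube hThm hv hB hsing
  exact uniformApexConcentration_of_floors hv hc hfl

end Summit.NavierStokesRegularity.NavierStokesRegularity.Cruxes.TypeIQuantSubcubicExp.QuietCore
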